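import Summits.AtomisticToContinuum.HydrodynamicLimit.Theorems.DensityCap.Negative.Packing
import Summits.AtomisticToContinuum.HydrodynamicLimit.Theses.InformationPercolationEngine
import Summits.AtomisticToContinuum.HydrodynamicLimit.Theorems.DenseExcursion.Negative.Everywhere
import Literature.Analysis.FluidPDE.HardSpherePhaseSpaceProofs
import Literature.Analysis.FluidPDE.HardSphereRegularGeometry

/-!
# `KineticClosure` (route InformationPercolationEngine): the DENSITY third of its conclusion follows from `DensityCap` alone

Helper for the support item `InformationPercolationEngine.KineticClosure` (stmt-AtomisticToContinuum-13482,
`ContactChaos → CollisionRate → LocalSecondLaw → DensityCap → HsEosLowDensity → DiluteSelfConsistency →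
HydrodynamicLimit`). The conclusion `HydrodynamicLimit` asks, at every `t < T`, for convergence in probability of the
three empirical fields (density, momentum, energy) of the deterministically evolved configuration to those of the
classical hard-sphere-Euler solution. This file proves that the DENSITY component is already a consequence of the
single hypothesis `DensityCap` (the one-sided "no overcompression" cap), with no kinetic theory:

* `integral_abs_sub_le_of_le_add` — on the Haar probability space `𝕋³`, a one-sided bound `f ≤ g + η` between two
  integrable functions of EQUAL integral is an `L¹` bound `∫|f − g| ≤ 2η`;
* `abs_empiricalDensityField_sub_integral_mul_mollDensity_le` — the `r`-mollified empirical density tested against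
  `χ` differs from the empirical density field of `χ` by at most the `r`-modulus of continuity of `χ` (the cone kernel
  is a probability density supported in the minimal-image ball of radius `r`, `integral_cone_eq_one'`);
* `tendsto_densityField_of_densityCap` — MAIN: `DensityCap` ⟹ for all continuous positive profiles there is
  `σ₀ > 0` (the cap's threshold, cut at `1/2`) such that for `0 < σ < σ₀`, every classical solution on `[0,T)`, every
  flow family and every `t = 0` tie, the empirical density field at every `t ∈ [0,T)` converges in probability to
  `∫ χ ρ(t)`. Proof: off the overshoot event the mollified empirical density is `≤ ρ(t) + η` everywhere; both have
  unit mass (`integral_mollDensity_eq_one`; mass conservation `integral_density_eq` + admissible mass one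
  `integral_density_zero_eq_one`), so they are `2η`-close in `L¹`; the mollification costs `ω_χ(r)`; the overshoot
  event has probability `≤ δ'` for `N ≥ N₀(r)`, `r < r₀(η, δ')`.

What this does NOT give (recorded for the planner; see the item's notes): the momentum and energy components. Their
fluxes (kinetic `v ⊗ v`, `v|v|²/2`, and the collisional transfer read off the empirical collision measure with marks
linear/quadratic in the relative velocity) are not controlled by any hypothesis of `KineticClosure` — bounded-mark
`ContactChaos`, cut-off `CollisionRate`, `LocalSecondLaw`, `DensityCap`, the EOS fact and diluteness carry no
velocity-tail information (`Literature.Barriers.AtomisticToContinuum.HighMomentumCutoffBarrierNarrow`).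
prover-pitem-stmt-AtomisticToContinuum-13482-0.
-/

noncomputable section

namespace Summit.AtomisticToContinuum.HydrodynamicLimit.Theorems.KineticClosureDensity

open MeasureTheory Filter Set Topology
open scoped ENNReal
open Literature.MathematicalPhysics.KineticTheory Literature.Analysis.FluidPDE
open Literature.Analysis.FunctionSpaces
open Summit.AtomisticToContinuum.HydrodynamicLimit.Theorems.DensityCapNegative
  (cone mollDensity capEvent CapLimit cone_nonneg cone_le mollDensity_eq cone_eq_zero_of_le integral_cone
    coneMass_eq_one integral_mollDensity_eq_one integrable_mollDensity densityCap_iff)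
open Summit.AtomisticToContinuum.HydrodynamicLimit.Theorems.DenseExcursionEverywhere
  (integral_density_eq integral_density_zero_eq_one)

/-! ## §1 Two measure-theoretic lemmas on `𝕋³` -/

/-- **One-sided bound + equal mass ⟹ `L¹` bound.** On the Haar probability space `𝕋³`: if `f ≤ g + η` pointwise and
`∫ f = ∫ g` then `∫ |f − g| ≤ 2η` (`|f − g| = 2(f − g)₊ − (f − g)`, `(f − g)₊ ≤ η`, and `η ≥ 0` by integrating the
hypothesis). [folklore] -/
theorem integral_abs_sub_le_of_le_add {f g : T3 → ℝ} (hf : Integrable f volume) (hg : Integrable g volume)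
    (hfg : ∫ x, f x = ∫ x, g x) {η : ℝ} (hle : ∀ x, f x ≤ g x + η) :
    ∫ x, |f x - g x| ≤ 2 * η := by
  have hη : 0 ≤ η := by
    have h : ∫ x, f x ≤ ∫ x, (g x + η) := integral_mono hf (hg.add (integrable_const η)) hle
    have e : ∫ x, (g x + η) = (∫ x, g x) + η := by
      rw [integral_add hg (integrable_const η), integral_const, smul_eq_mul, probReal_univ, one_mul]
    rw [e, ← hfg] at h
    linarith
  have hpt : ∀ x, |f x - g x| = 2 * max (f x - g x) 0 - (f x - g x) := fun x => by
    rcases le_total 0 (f x - g x) with h | h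
    · rw [abs_of_nonneg h, max_eq_left h]; ring
    · rw [abs_of_nonpos h, max_eq_right h]; ring
  have hmax : ∀ x, max (f x - g x) 0 ≤ η := fun x => max_le (by linarith [hle x]) hη
  have hsub : Integrable (fun x => f x - g x) volume := hf.sub hg
  have hpos : Integrable (fun x => max (f x - g x) 0) volume := hsub.pos_part
  simp_rw [hpt]
  have e1 : ∫ x, (2 * max (f x - g x) 0 - (f x - g x)) = (∫ x, 2 * max (f x - g x) 0) - ∫ x, (f x - g x) :=
    integral_sub (hpos.const_mul 2) hsub
  have e2 : ∫ x, (f x - g x) = (∫ x, f x) - ∫ x, g x := integral_sub hf hg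
  rw [e1, integral_const_mul, e2, hfg, sub_self, sub_zero]
  have h2 : ∫ x, max (f x - g x) 0 ≤ ∫ _ : T3, η := integral_mono hpos (integrable_const η) hmax
  rw [integral_const, smul_eq_mul, probReal_univ, one_mul] at h2
  linarith

/-- The cone kernel is continuous in the centre. [folklore] -/
theorem continuous_cone_right (r : ℝ) (y : T3) : Continuous fun x : T3 => cone r y x := by
  unfold cone
  refine continuous_const.mul ((continuous_const.sub ?_).max continuous_const)
  exact (Torus.continuous_euclidDist.comp (continuous_const.prodMk continuous_id)).div_const r

/-- The mollified empirical density is continuous in the centre. [folklore] -/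
theorem continuous_mollDensity (r : ℝ) {n : ℕ} (w : Config n (Fin 3) T3) :
    Continuous fun x : T3 => mollDensity r w x := by
  have h : (fun x : T3 => mollDensity r w x) = fun x => (n : ℝ)⁻¹ * ∑ i, cone r (w i).1 x :=
    funext fun x => mollDensity_eq r w x
  rw [h]
  exact continuous_const.mul (continuous_finsetSum _ fun i _ => continuous_cone_right r (w i).1)

/-- The cone kernel is a probability density for `0 < r ≤ 1/2`: `∫ cone r y x dx = 1`. [folklore] -/
theorem integral_cone_eq_one' {r : ℝ} (hr : 0 < r) (hr2 : r ≤ 1 / 2) (y : T3) : ∫ x, cone r y x = 1 := by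
  rw [integral_cone, coneMass_eq_one hr hr2]

/-- **Mollification error.** If `|χ x − χ y| ≤ κ` whenever `d(x, y) < r` (minimal-image distance), then for every
configuration of `n ≥ 1` particles the empirical density field of `χ` and `χ` integrated against the `r`-mollified
empirical density differ by at most `κ` (`0 < r ≤ 1/2`): particle by particle,
`|χ(xᵢ) − ∫ χ b_r(xᵢ, ·)| = |∫ (χ(xᵢ) − χ) b_r(xᵢ, ·)| ≤ κ ∫ b_r(xᵢ, ·) = κ`. [folklore] -/
theorem abs_empiricalDensityField_sub_integral_mul_mollDensity_le {r : ℝ} (hr : 0 < r) (hr2 : r ≤ 1 / 2)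
    {χ : T3 → ℝ} (hχ : Continuous χ) {κ : ℝ} (hmod : ∀ x y, Torus.euclidDist x y < r → |χ x - χ y| ≤ κ)
    {n : ℕ} (hn : n ≠ 0) (w : Config n (Fin 3) T3) :
    |empiricalDensityField w χ - ∫ x, χ x * mollDensity r w x| ≤ κ := by
  -- integrability of the summands
  have hci : ∀ i : Fin n, Integrable (fun x : T3 => χ x * cone r (w i).1 x) volume := fun i =>
    integrable_of_continuous_T3 (hχ.mul (continuous_cone_right r (w i).1))
  -- rewrite both sides as averages
  have hint : ∫ x, χ x * mollDensity r w x = (n : ℝ)⁻¹ * ∑ i, ∫ x, χ x * cone r (w i).1 x := by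
    have h : (fun x => χ x * mollDensity r w x) = fun x => (n : ℝ)⁻¹ * ∑ i, χ x * cone r (w i).1 x := by
      funext x
      rw [mollDensity_eq, mul_left_comm, Finset.mul_sum]
    rw [h, integral_const_mul, integral_finsetSum _ fun i _ => hci i]
  rw [empiricalDensityField_eq_sum, hint, ← mul_sub, ← Finset.sum_sub_distrib, abs_mul,
    abs_of_nonneg (inv_nonneg.2 (Nat.cast_nonneg n))]
  -- particle by particle
  have hpp : ∀ i : Fin n, |χ (w i).1 - ∫ x, χ x * cone r (w i).1 x| ≤ κ := by
    intro i
    set y := (w i).1 with hy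
    have hc : Integrable (fun x : T3 => cone r y x) volume := integrable_of_continuous_T3 (continuous_cone_right r y)
    have h1 : χ y = ∫ x, χ y * cone r y x := by
      rw [integral_const_mul, integral_cone_eq_one' hr hr2, mul_one]
    rw [h1, ← integral_sub (hc.const_mul _) (hci i)]
    calc |∫ x, (χ y * cone r y x - χ x * cone r y x)|
        ≤ ∫ x, |χ y * cone r y x - χ x * cone r y x| := abs_integral_le_integral_abs
      _ ≤ ∫ x, κ * cone r y x := by
          refine integral_mono_of_nonneg (ae_of_all _ fun x => abs_nonneg _) (hc.const_mul κ)
            (ae_of_all _ fun x => ?_)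
          show |χ y * cone r y x - χ x * cone r y x| ≤ κ * cone r y x
          rw [← sub_mul, abs_mul, abs_of_nonneg (cone_nonneg hr _ _)]
          by_cases hd : Torus.euclidDist y x < r
          · exact mul_le_mul_of_nonneg_right (hmod y x hd) (cone_nonneg hr _ _)
          · rw [cone_eq_zero_of_le hr (not_lt.1 hd), mul_zero, mul_zero]
      _ = κ := by rw [integral_const_mul, integral_cone_eq_one' hr hr2, mul_one]
  have hn' : (0 : ℝ) < n := by exact_mod_cast Nat.pos_of_ne_zero hn
  calc (n : ℝ)⁻¹ * |∑ i, (χ (w i).1 - ∫ x, χ x * cone r (w i).1 x)|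
      ≤ (n : ℝ)⁻¹ * ∑ i, |χ (w i).1 - ∫ x, χ x * cone r (w i).1 x| := by
        gcongr
        exact Finset.abs_sum_le_sum_abs _ _
    _ ≤ (n : ℝ)⁻¹ * ∑ _i : Fin n, κ := by
        gcongr with i _
        exact hpp i
    _ = κ := by
        rw [Finset.sum_const, Finset.card_univ, Fintype.card_fin, nsmul_eq_mul, ← mul_assoc,
          inv_mul_cancel₀ hn'.ne', one_mul]

/-- A continuous function on `𝕋³` has a modulus of continuity in the minimal-image distance: for every `κ > 0`
there is `r > 0` with `|χ x − χ y| ≤ κ` whenever `d(x, y) < r` (uniform continuity on the compact torus; Mathlib's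
sup-distance is dominated by the minimal-image distance, `Torus.norm_sub_le_euclidDist`). [folklore] -/
theorem exists_modulus_euclidDist {χ : T3 → ℝ} (hχ : Continuous χ) {κ : ℝ} (hκ : 0 < κ) :
    ∃ r : ℝ, 0 < r ∧ ∀ x y, Torus.euclidDist x y < r → |χ x - χ y| ≤ κ := by
  have huc : UniformContinuous χ := CompactSpace.uniformContinuous_of_continuous hχ
  obtain ⟨r, hr, h⟩ := Metric.uniformContinuous_iff.1 huc κ hκ
  refine ⟨r, hr, fun x y hxy => ?_⟩
  have hd : dist x y < r :=
    calc dist x y = ‖x - y‖ := dist_eq_norm x y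
      _ ≤ Torus.euclidDist x y := Torus.norm_sub_le_euclidDist_holds x y
      _ < r := hxy
  have := h hd
  rw [Real.dist_eq] at this
  exact this.le

/-! ## §2 The density component of the hydrodynamic limit from `DensityCap` -/

/-- **`DensityCap` ⟹ the density third of `HydrodynamicLimit`'s conclusion.** For all continuous positive profiles
there is `σ₀ > 0` such that for `0 < σ < σ₀`, every classical hard-sphere-Euler solution on `[0, T)`, every flow
family and every `t = 0` tie, at every `t ∈ [0, T)` the empirical DENSITY field of the evolved configuration tested
against any continuous `χ` converges in probability to `∫ χ ρ(t)`. (`σ₀` = the cap's threshold cut at `1/2`; off the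
overshoot event `{∃ s ≤ t, ∃ x, ρ̄ʳ > ρ + η}` the mollified empirical density is `2η`-close to `ρ(t)` in `L¹` because
both have unit mass, and `χ`-testing the mollified density costs the `r`-modulus of `χ`.) [folklore] -/
theorem tendsto_densityField_of_densityCap
    (hD : Summit.AtomisticToContinuum.HydrodynamicLimit.Theses.InformationPercolationEngine.DensityCap)
    (a₀ θ₀ : T3 → ℝ) (u₀ : T3 → V3) (ha : Continuous a₀) (hθ : Continuous θ₀) (hu : Continuous u₀)
    (ha0 : ∀ x, 0 < a₀ x) (hθ0 : ∀ x, 0 < θ₀ x) :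
    ∃ σ₀ : ℝ, 0 < σ₀ ∧ ∀ σ : ℝ, 0 < σ → σ < σ₀ →
      ∀ (T : ℝ) (ρ θ : ℝ → T3 → ℝ) (u : ℝ → T3 → V3), IsHardSphereEulerSolution σ T ρ u θ →
        ∀ Φ : (N : ℕ) → HardSphereFlow (Torus.geometry (Fin 3)) (hsDiameter σ N) (N + 1),
          TendstoHydroFieldsAt (fun N => localGibbsLaw σ a₀ u₀ θ₀ N (Φ N)) Φ ρ u θ 0 →
            ∀ t ∈ Ico 0 T, ∀ χ : T3 → ℝ, Continuous χ → ∀ δ > (0 : ℝ),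
              Tendsto (fun N => localGibbsLaw σ a₀ u₀ θ₀ N (Φ N)
                {z | δ < |empiricalDensityField ((Φ N).flow t z) χ - ∫ x, χ x * ρ t x|}) atTop (𝓝 0) := by
  -- the route's `DensityCap` is VERBATIM `JParityClosure.DensityCap`, whose vocabulary form is `densityCap_iff`
  have hD' := densityCap_iff.1
    (show Summit.AtomisticToContinuum.HydrodynamicLimit.Theses.JParityClosure.DensityCap from hD)
  obtain ⟨σ₁, hσ₁, H⟩ := hD' a₀ θ₀ u₀ ha hθ hu ha0 hθ0
  refine ⟨min σ₁ (1 / 2), lt_min hσ₁ (by norm_num), fun σ hσ hσlt T ρ θ u hE Φ hA t ht χ hχ δ hδ => ?_⟩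
  have hσ₁' : σ < σ₁ := hσlt.trans_le (min_le_left _ _)
  have hσ2 : σ ≤ 1 / 2 := (hσlt.trans_le (min_le_right _ _)).le
  have hcap : CapLimit σ a₀ u₀ θ₀ Φ ρ t := H σ hσ hσ₁' T ρ θ u hE Φ hA t ht
  -- conserved unit mass of the classical solution
  have hmass : ∫ x, ρ t x = 1 :=
    (integral_density_eq hE ht).trans (integral_density_zero_eq_one hσ2 ha hθ hu ha0 hθ0 Φ hA)
  have hρcont : Continuous (ρ t) := (hE.smooth_density.isSmooth_slice ht).continuous
  have hρint : Integrable (ρ t) volume := integrable_of_continuous_T3 hρcont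
  -- a sup bound and a modulus of continuity for `χ`
  obtain ⟨C, hC⟩ : ∃ C : ℝ, ∀ x, |χ x| ≤ C := by
    obtain ⟨C, hC⟩ := isCompact_univ.exists_bound_of_continuousOn hχ.continuousOn
    exact ⟨C, fun x => by simpa [Real.norm_eq_abs] using hC x (mem_univ x)⟩
  have hC0 : 0 ≤ C := (abs_nonneg _).trans (hC 0)
  obtain ⟨r₁, hr₁, hmod⟩ := exists_modulus_euclidDist hχ (show (0 : ℝ) < δ / 3 by positivity)
  -- the cap level
  set η : ℝ := δ / (6 * (C + 1)) with hη_def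
  have hη : 0 < η := by positivity
  have hCη : C * (2 * η) ≤ δ / 3 := by
    rw [hη_def]
    rw [show C * (2 * (δ / (6 * (C + 1)))) = (δ / 3) * (C / (C + 1)) by field_simp; ring]
    exact mul_le_of_le_one_right (by positivity) ((div_le_one (by positivity)).2 (by linarith))
  rw [ENNReal.tendsto_atTop_zero]
  intro ε hε
  obtain ⟨δ', hδ', hδ'ε⟩ : ∃ δ' : ℝ, 0 < δ' ∧ ENNReal.ofReal δ' ≤ ε := by
    rcases eq_or_ne ε ⊤ with h | h
    · exact ⟨1, one_pos, h ▸ le_top⟩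
    · exact ⟨ε.toReal, ENNReal.toReal_pos hε.ne' h, (ENNReal.ofReal_toReal h).le⟩
  obtain ⟨r₀, hr₀, Hr⟩ := hcap η δ' hη hδ'
  set r : ℝ := min (r₀ / 2) (min r₁ (1 / 2)) with hr_def
  have hr : 0 < r := lt_min (by positivity) (lt_min hr₁ (by norm_num))
  have hrr₀ : r < r₀ := (min_le_left _ _).trans_lt (by linarith)
  have hrr₁ : r ≤ r₁ := (min_le_right _ _).trans (min_le_left _ _)
  have hr2 : r ≤ 1 / 2 := (min_le_right _ _).trans (min_le_right _ _)
  obtain ⟨N₀, HN⟩ := Hr r hr hrr₀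
  refine ⟨N₀, fun N hN => (measure_mono ?_).trans ((HN N hN).trans hδ'ε)⟩
  -- the deviation event is contained in the overshoot event
  intro z hz
  by_contra hzc
  have hle : ∀ x, mollDensity r ((Φ N).flow t z) x ≤ ρ t x + η := fun x =>
    not_lt.1 fun h => hzc ⟨t, ⟨ht.1, le_rfl⟩, x, h⟩
  set w := (Φ N).flow t z with hw
  have hmod' : ∀ x y, Torus.euclidDist x y < r → |χ x - χ y| ≤ δ / 3 := fun x y hxy =>
    hmod x y (hxy.trans_le hrr₁)
  -- (a) mollification error
  have ha' : |empiricalDensityField w χ - ∫ x, χ x * mollDensity r w x| ≤ δ / 3 :=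
    abs_empiricalDensityField_sub_integral_mul_mollDensity_le hr hr2 hχ hmod' (Nat.succ_ne_zero N) w
  -- (b) L¹ closeness of the mollified density to `ρ(t)`
  have hL1 : ∫ x, |mollDensity r w x - ρ t x| ≤ 2 * η :=
    integral_abs_sub_le_of_le_add (integrable_mollDensity hr w) hρint
      (by rw [integral_mollDensity_eq_one hr hr2 (Nat.succ_ne_zero N) w, hmass]) hle
  have hint1 : Integrable (fun x => χ x * mollDensity r w x) volume :=
    integrable_of_continuous_T3 (hχ.mul (continuous_mollDensity r w))
  have hint2 : Integrable (fun x => χ x * ρ t x) volume := integrable_of_continuous_T3 (hχ.mul hρcont)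
  have hb' : |(∫ x, χ x * mollDensity r w x) - ∫ x, χ x * ρ t x| ≤ δ / 3 := by
    rw [← integral_sub hint1 hint2]
    calc |∫ x, (χ x * mollDensity r w x - χ x * ρ t x)|
        ≤ ∫ x, |χ x * mollDensity r w x - χ x * ρ t x| := abs_integral_le_integral_abs
      _ ≤ ∫ x, C * |mollDensity r w x - ρ t x| := by
          refine integral_mono_of_nonneg (ae_of_all _ fun x => abs_nonneg _)
            (((integrable_mollDensity hr w).sub hρint).abs.const_mul C) (ae_of_all _ fun x => ?_)
          show |χ x * mollDensity r w x - χ x * ρ t x| ≤ C * |mollDensity r w x - ρ t x|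
          rw [← mul_sub, abs_mul]
          exact mul_le_mul_of_nonneg_right (hC x) (abs_nonneg _)
      _ = C * ∫ x, |mollDensity r w x - ρ t x| := integral_const_mul _ _
      _ ≤ C * (2 * η) := by gcongr
      _ ≤ δ / 3 := hCη
  have htri : |empiricalDensityField w χ - ∫ x, χ x * ρ t x| ≤ δ / 3 + δ / 3 :=
    (abs_sub_le _ _ _).trans (add_le_add ha' hb')
  have hz' : δ < |empiricalDensityField w χ - ∫ x, χ x * ρ t x| := hz
  linarith

/-! ## §3 Uniformly in time -/

/-- **Uniform-in-time version.** Under the same hypotheses, the deviation of the empirical density field from `∫ χ ρ(s)`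
is small SIMULTANEOUSLY at all times `s ∈ [0, t]` with probability `→ 1`: the cap of `DensityCap` is uniform over
`s ∈ [0, t]`, and mass is `1` at every `s` — the form a relative-energy/Gronwall argument consumes. [folklore] -/
theorem tendsto_densityField_uniform_of_densityCap
    (hD : Summit.AtomisticToContinuum.HydrodynamicLimit.Theses.InformationPercolationEngine.DensityCap)
    (a₀ θ₀ : T3 → ℝ) (u₀ : T3 → V3) (ha : Continuous a₀) (hθ : Continuous θ₀) (hu : Continuous u₀)
    (ha0 : ∀ x, 0 < a₀ x) (hθ0 : ∀ x, 0 < θ₀ x) :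
    ∃ σ₀ : ℝ, 0 < σ₀ ∧ ∀ σ : ℝ, 0 < σ → σ < σ₀ →
      ∀ (T : ℝ) (ρ θ : ℝ → T3 → ℝ) (u : ℝ → T3 → V3), IsHardSphereEulerSolution σ T ρ u θ →
        ∀ Φ : (N : ℕ) → HardSphereFlow (Torus.geometry (Fin 3)) (hsDiameter σ N) (N + 1),
          TendstoHydroFieldsAt (fun N => localGibbsLaw σ a₀ u₀ θ₀ N (Φ N)) Φ ρ u θ 0 →
            ∀ t ∈ Ico 0 T, ∀ χ : T3 → ℝ, Continuous χ → ∀ δ > (0 : ℝ),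
              Tendsto (fun N => localGibbsLaw σ a₀ u₀ θ₀ N (Φ N)
                {z | ∃ s ∈ Icc 0 t, δ < |empiricalDensityField ((Φ N).flow s z) χ - ∫ x, χ x * ρ s x|})
                atTop (𝓝 0) := by
  have hD' := densityCap_iff.1
    (show Summit.AtomisticToContinuum.HydrodynamicLimit.Theses.JParityClosure.DensityCap from hD)
  obtain ⟨σ₁, hσ₁, H⟩ := hD' a₀ θ₀ u₀ ha hθ hu ha0 hθ0
  refine ⟨min σ₁ (1 / 2), lt_min hσ₁ (by norm_num), fun σ hσ hσlt T ρ θ u hE Φ hA t ht χ hχ δ hδ => ?_⟩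
  have hσ₁' : σ < σ₁ := hσlt.trans_le (min_le_left _ _)
  have hσ2 : σ ≤ 1 / 2 := (hσlt.trans_le (min_le_right _ _)).le
  have hcap : CapLimit σ a₀ u₀ θ₀ Φ ρ t := H σ hσ hσ₁' T ρ θ u hE Φ hA t ht
  -- a sup bound and a modulus of continuity for `χ`
  obtain ⟨C, hC⟩ : ∃ C : ℝ, ∀ x, |χ x| ≤ C := by
    obtain ⟨C, hC⟩ := isCompact_univ.exists_bound_of_continuousOn hχ.continuousOn
    exact ⟨C, fun x => by simpa [Real.norm_eq_abs] using hC x (mem_univ x)⟩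
  have hC0 : 0 ≤ C := (abs_nonneg _).trans (hC 0)
  obtain ⟨r₁, hr₁, hmod⟩ := exists_modulus_euclidDist hχ (show (0 : ℝ) < δ / 3 by positivity)
  set η : ℝ := δ / (6 * (C + 1)) with hη_def
  have hη : 0 < η := by positivity
  have hCη : C * (2 * η) ≤ δ / 3 := by
    rw [hη_def]
    rw [show C * (2 * (δ / (6 * (C + 1)))) = (δ / 3) * (C / (C + 1)) by field_simp; ring]
    exact mul_le_of_le_one_right (by positivity) ((div_le_one (by positivity)).2 (by linarith))
  rw [ENNReal.tendsto_atTop_zero]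
  intro ε hε
  obtain ⟨δ', hδ', hδ'ε⟩ : ∃ δ' : ℝ, 0 < δ' ∧ ENNReal.ofReal δ' ≤ ε := by
    rcases eq_or_ne ε ⊤ with h | h
    · exact ⟨1, one_pos, h ▸ le_top⟩
    · exact ⟨ε.toReal, ENNReal.toReal_pos hε.ne' h, (ENNReal.ofReal_toReal h).le⟩
  obtain ⟨r₀, hr₀, Hr⟩ := hcap η δ' hη hδ'
  set r : ℝ := min (r₀ / 2) (min r₁ (1 / 2)) with hr_def
  have hr : 0 < r := lt_min (by positivity) (lt_min hr₁ (by norm_num))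
  have hrr₀ : r < r₀ := (min_le_left _ _).trans_lt (by linarith)
  have hrr₁ : r ≤ r₁ := (min_le_right _ _).trans (min_le_left _ _)
  have hr2 : r ≤ 1 / 2 := (min_le_right _ _).trans (min_le_right _ _)
  obtain ⟨N₀, HN⟩ := Hr r hr hrr₀
  refine ⟨N₀, fun N hN => (measure_mono ?_).trans ((HN N hN).trans hδ'ε)⟩
  -- the uniform deviation event is contained in the overshoot event
  rintro z ⟨s, hs, hz⟩
  by_contra hzc
  have hsT : s ∈ Ico 0 T := ⟨hs.1, hs.2.trans_lt ht.2⟩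
  have hle : ∀ x, mollDensity r ((Φ N).flow s z) x ≤ ρ s x + η := fun x =>
    not_lt.1 fun h => hzc ⟨s, hs, x, h⟩
  set w := (Φ N).flow s z with hw
  have hmass : ∫ x, ρ s x = 1 :=
    (integral_density_eq hE hsT).trans (integral_density_zero_eq_one hσ2 ha hθ hu ha0 hθ0 Φ hA)
  have hρcont : Continuous (ρ s) := (hE.smooth_density.isSmooth_slice hsT).continuous
  have hρint : Integrable (ρ s) volume := integrable_of_continuous_T3 hρcont
  have hmod' : ∀ x y, Torus.euclidDist x y < r → |χ x - χ y| ≤ δ / 3 := fun x y hxy =>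
    hmod x y (hxy.trans_le hrr₁)
  have ha' : |empiricalDensityField w χ - ∫ x, χ x * mollDensity r w x| ≤ δ / 3 :=
    abs_empiricalDensityField_sub_integral_mul_mollDensity_le hr hr2 hχ hmod' (Nat.succ_ne_zero N) w
  have hL1 : ∫ x, |mollDensity r w x - ρ s x| ≤ 2 * η :=
    integral_abs_sub_le_of_le_add (integrable_mollDensity hr w) hρint
      (by rw [integral_mollDensity_eq_one hr hr2 (Nat.succ_ne_zero N) w, hmass]) hle
  have hint1 : Integrable (fun x => χ x * mollDensity r w x) volume :=
    integrable_of_continuous_T3 (hχ.mul (continuous_mollDensity r w))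
  have hint2 : Integrable (fun x => χ x * ρ s x) volume := integrable_of_continuous_T3 (hχ.mul hρcont)
  have hb' : |(∫ x, χ x * mollDensity r w x) - ∫ x, χ x * ρ s x| ≤ δ / 3 := by
    rw [← integral_sub hint1 hint2]
    calc |∫ x, (χ x * mollDensity r w x - χ x * ρ s x)|
        ≤ ∫ x, |χ x * mollDensity r w x - χ x * ρ s x| := abs_integral_le_integral_abs
      _ ≤ ∫ x, C * |mollDensity r w x - ρ s x| := by
          refine integral_mono_of_nonneg (ae_of_all _ fun x => abs_nonneg _)
            (((integrable_mollDensity hr w).sub hρint).abs.const_mul C) (ae_of_all _ fun x => ?_)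
          show |χ x * mollDensity r w x - χ x * ρ s x| ≤ C * |mollDensity r w x - ρ s x|
          rw [← mul_sub, abs_mul]
          exact mul_le_mul_of_nonneg_right (hC x) (abs_nonneg _)
      _ = C * ∫ x, |mollDensity r w x - ρ s x| := integral_const_mul _ _
      _ ≤ C * (2 * η) := by gcongr
      _ ≤ δ / 3 := hCη
  have htri : |empiricalDensityField w χ - ∫ x, χ x * ρ s x| ≤ δ / 3 + δ / 3 :=
    (abs_sub_le _ _ _).trans (add_le_add ha' hb')
  linarith

end Summit.AtomisticToContinuum.HydrodynamicLimit.Theorems.KineticClosureDensity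

end
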